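import Summits.BirchSwinnertonDyer.BirchSwinnertonDyer.Theorems.ManinLocalTwoThreeShimuraIndexValues
import Summits.BirchSwinnertonDyer.BirchSwinnertonDyer.Theorems.ManinLocalTwoThreeShimuraIndexTotient
import Summits.BirchSwinnertonDyer.BirchSwinnertonDyer.Theorems.ManinLocalTwoThreeQuarterShiftGamma1Orbit
import Summits.BirchSwinnertonDyer.BirchSwinnertonDyer.Theorems.ManinLocalTwoThreeSigmaHabitatHolds
import Summits.BirchSwinnertonDyer.BirchSwinnertonDyer.Theorems.ManinLocalTwoThreeEtaIdentitiesFortyEight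
import Summits.BirchSwinnertonDyer.BirchSwinnertonDyer.Theorems.ManinLocalTwoThreeNeronSqueezeTwentyFour
import Summits.BirchSwinnertonDyer.BirchSwinnertonDyer.Theorems.ManinLocalTwoThreeNonVacuityTwenty
import HarnessLib

/-!
# THE SHIMURA INDEX ALONG `χ₋₄`-TWINS: `[Λ₀ : Λ₁] = 2` EXACTLY at `N = 48` (genus `3`, DECIDED for every datum) and `N = 80`
# (genus `7`), and «Stevens' curve = optimal curve» transported from an odd-rank twin
Summit `BirchSwinnertonDyer`, route `ManinLocalTwoThree`, crux C2 `ManinOddAtFour` (stmt-BirchSwinnertonDyer-22967); cell bsd-f2-manin,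
es lens, gen 46, turnkey T-es-109 (`--supports stmt-BirchSwinnertonDyer-22967`).  Sequel to `…ShimuraIndexValues` (T-es-107: the Shimura
index `[Λ₀(f) : Λ₁(f)] = 2` for EVERY `f ≠ 0` at `N = 20, 24, 32`), `…ShimuraIndexTotient` (T-es-108: the quotient is finite) and the LEAD's
`…QuarterShiftGamma1Orbit` (the index is a `χ₋₄`-ORBIT INVARIANT along every edge `N ∣ N′ ∣ 4N`, `16 ∣ N′`, both curves additive at `2`),
joined to the LEAD's level pinning at `20`, `24`, `48` (`…NonVacuityTwenty`, `…NeronSqueezeTwentyFour`, `…NewformPinningFortyEight`).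

* §1 **`p ∣ [Λ₀(f) : Λ₁(f)] ↔ ¬ ShimuraIndexPrimeTo p f`** (`dvd_relIndex_iff_not_shimuraIndexPrimeTo`, Cauchy in the finite quotient
  `Λ₀(f)/Λ₁(f)`) and `[Λ₀ : Λ₁] = 1 ↔ Λ₁ = Λ₀` — the dictionary between the `relIndex` values of T-es-107 and the `p`-torsion
  predicates `ShimuraIndexPrimeTo p` of the leaf `ShimuraIndexFrickeLaw`, for every level and every `f`.
* §2 **EXACT VALUES BY TRANSPORT** (`relIndex_eq_two_of_negOne_twist_twenty / _twentyFour`, `relIndex_eighty_of_negOne_twist`,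
  `relIndex_fortyEight_of_negOne_twist`): for data `D` of `W` at `N = 20` (resp. `24`) and `D′` of `W′ ~ W ⊗ χ₋₄` at `N′ = 80` (resp. `48`),
  **`[Λ₀(f_{D′}) : Λ₁(f_{D′})] = 2`** — hence `¬ ShimuraIndexPrimeTo 2 f_{D′}` and `Λ₁(f_{D′}) ≠ Λ₀(f_{D′})` (the strong `X₁(N′)`-curve
  is NOT the strong `X₀(N′)`-curve), and `ShimuraIndexPrimeTo p f_{D′}` at every odd `p`.
* §3 **LEVEL `48` DECIDED** (`relIndex_eq_two_fortyEight`, `relIndex_phi48_eq_two`): **`[Λ₀(f_D) : Λ₁(f_D)] = 2` for EVERY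
  `X₀(48)`-datum `D` of EVERY elliptic `W/ℚ`**, and `[Λ₀(φ₄₈) : Λ₁(φ₄₈)] = 2` for the `η`-product `φ₄₈ = η₄⁴η₁₂⁴/(η₂η₆η₈η₂₄)`,
  assuming ONLY the item's modularity binder `exists_isNewformOf` (it supplies auxiliary data of the literal models
  `24a1 = [0,−1,0,−4,4]`, `48a1 ≅ [0,−2,0,−3,0]`; the twin isogeny `24a1 ⊗ χ₋₄ ≅ 48a1` is the translate `x ↦ x − 1`,
  `isIsogenous_quadraticTwist_twentyFourA1_fortyEightA1`; the pinning `f_D = φ₄₈` removes `W`).  The first EXACT Shimura index at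
  genus `> 1` in the tree with NO Hecke datum: at `48` cuspidal inertia only bounds the quotient by `(ℤ/12)ˣ/{±1} ⊗ 𝔽₂ = ℤ/2` and every
  transparent Hecke separator has an EVEN multiplier (the old class `24a` is Eisenstein mod `2`), so neither the group theory nor
  THEOREM B of `…ShimuraEisenstein` decides it.  Level `80`: the `20a1`-side is
  discharged the same way (`relIndex_eq_two_eighty_of_isIsogenous_twentyA1_twist`, twin `20a1 ⊗ χ₋₄ = [0,−1,0,4,−4]`); the genus-`7` level
  `80` has no newform pinning in the tree, whence the residual hypothesis `W′ ~ 20a1 ⊗ χ₋₄`.  Census E15-LATTICE-INDEX-v1 (eclib):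
  `48a1 ↦ 2`, `80b1 ↦ 2` ✓ (LEAD g15 census shadow: `48a = 24a ⊗ χ₋₄`, `80b = 20a ⊗ χ₋₄`, isogeny graphs `[1,2,2,2,4,4]` / `[1,2,3,6]`).
* §4 **ROOT NUMBER TRANSPORT** (`periodLatticeGamma1_eq_of_negOne_twist_of_rootNumber_twin`, `…_of_rootNumber_eq_neg_one_of_negOne_twist`):
  if ONE end of a `χ₋₄`-edge is a globally minimal curve of root number `−1` (tree `periodLatticeGamma1_eq_of_rootNumber_eq_neg_one`:
  `Λ₁ = Λ₀` there), then `Λ₁ = Λ₀` at the OTHER end too — a curve of root number `+1` whose Shimura `2`-class is invisible to the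
  Eisenstein sieve (all `a_ℓ` even).  Census instance: `56b1 ↦ 1` (E15 ✓) from its rank-one twin `112a1` (`a₇(56b) = +1`, `a₇(112a) = −1`,
  isogeny graphs `[1,2]`); at `128` (E15: `128a1` rank `1`, `a, c ↦ 1`, `b, d ↦ 2`) the orbit law PREDICTS the `χ₋₄`-pairing `{a,c}`, `{b,d}`.
* §5 the conditional edge `52 → 208`: `[Λ₀ : Λ₁] = 2` for the `χ₋₄`-twin data at `208` from the level-`52` Hecke datum of
  `…ShimuraEisensteinFiftyTwo` (E15 `208c1 ↦ 2`).
* NOT a `χ₋₃`-analogue: along `χ₋₃`-twins the index MOVES (E15: `54a1 ↦ 3`, `54b1 = 54a1 ⊗ χ₋₃ ↦ 1`) —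
  `f ⊗ χ₋₃ = (f + 2·f|t_{1/3})/(i√3)` is not a single translate, so only `i√3·Λ₁(f ⊗ χ₋₃) ⊆ Λ₁(f)`-type sandwiches (index ratio `∣ 9`)
  survive; nothing is claimed at `9 ∣ N` here.

HONEST FRAMING: printed mathematics (Stevens 1989 §2; Ling–Oesterlé 1991 Thm. 1), new formal proofs; §§2, 4, 5 carry the twin relation
`W′ ~ W ⊗ χ₋₄` and the data as HYPOTHESES; §3 assumes only C2's own binder `exists_isNewformOf` (modularity); beyond-print theorem NO;
Manin's `c = 1`, C2 and BSD are NOT proved.  Kernel-checked, standard axioms, no Literature fact consumed beyond that binder, no `sorry`,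
no new definitions.

References: [Stevens1989] §2 and Lemma (5.4); [LingOesterle1991] §1, Thm. 1, Thm. 6; [Manin1972] Thm. 1.6; [CremonaAlgorithms1997] §2.8,
Tables 1 and 3 (`N = 20, 24, 48, 80`).
-/

set_option autoImplicit false

noncomputable section

-- justification: the `Summit.BirchSwinnertonDyer.BirchSwinnertonDyer.…` path repeats a component (route-file convention)
set_option linter.dupNamespace false

open scoped Classical MatrixGroups

open CongruenceSubgroup
open WeierstrassCurve Literature.NumberTheory.EllipticCurves Literature.NumberTheory.EllipticCurves.ModularForms
open Literature.NumberTheory.Automorphic (nonempty_modularParametrizationData_of_isNewformOf)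
open Summit.BirchSwinnertonDyer.BirchSwinnertonDyer.Theorems.ManinLocalTwoThree.NewformFortyEight (exists_cuspForm_phi48 f_eq_phi48)
open Summit.BirchSwinnertonDyer.BirchSwinnertonDyer.Theorems.ManinLocalTwoThree.EtaIdentitiesFortyEight
  (isElliptic_fortyEightA1 conductorNorm_fortyEightA1 exists_isNewformOf_fortyEightA1)
open Summit.BirchSwinnertonDyer.BirchSwinnertonDyer.Theorems.ManinLocalTwoThree.LevelTwentyFour
  (isElliptic_twentyFourA1 conductorNorm_twentyFourA1 exists_isNewformOf_twentyFourA1)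
open Summit.BirchSwinnertonDyer.BirchSwinnertonDyer.Theorems.ManinLocalTwoThree.NonVacuityTwenty (conductorNorm_twentyA1 exists_isNewformOf_twentyA1)
open Summit.BirchSwinnertonDyer.BirchSwinnertonDyer.Theorems.AddPotGoodPrint (isElliptic_20a1)
open Summit.BirchSwinnertonDyer.Rank1Residual.ManinAdditive.KatoCurve (ShimuraIndexPrimeTo)
open Summit.BirchSwinnertonDyer.BirchSwinnertonDyer.Theorems.ManinLocalTwoThree.SigmaHabitat
open Summit.BirchSwinnertonDyer.BirchSwinnertonDyer.Theorems.ManinLocalTwoThree.ShimuraEisenstein (separatorFiftyTwo)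
open Summit.BirchSwinnertonDyer.BirchSwinnertonDyer.Theorems.ManinLocalTwoThree.CuspLifting (periodLatticeGamma1_eq_of_rootNumber_eq_neg_one)

namespace Summit.BirchSwinnertonDyer.BirchSwinnertonDyer.Theorems.ManinLocalTwoThree.ShimuraIndex

/-! ## §1. The dictionary `p ∣ [Λ₀ : Λ₁] ↔ ¬ ShimuraIndexPrimeTo p` -/

section Dictionary

variable {N : ℕ} [NeZero N] (f : CuspForm (Gamma0 N) 2)

/-- **`p ∣ [Λ₀(f) : Λ₁(f)] ↔ Λ₀(f)/Λ₁(f)` has `p`-torsion** (`↔ ¬ ShimuraIndexPrimeTo p f`), for every prime `p`, every level and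
every `f`: Cauchy's theorem in the finite group `Λ₀(f)/Λ₁(f)` (finite by `relIndex_ne_zero`). [cite: LingOesterle1991, §1] -/
theorem dvd_relIndex_iff_not_shimuraIndexPrimeTo {p : ℕ} (hp : p.Prime) :
    p ∣ (periodLatticeGamma1 f).relIndex (periodLattice f) ↔ ¬ ShimuraIndexPrimeTo p f := by
  set H : AddSubgroup (periodLattice f) := (periodLatticeGamma1 f).addSubgroupOf (periodLattice f) with hH
  have hidx : (periodLatticeGamma1 f).relIndex (periodLattice f) = Nat.card (periodLattice f ⧸ H) := by
    rw [← AddSubgroup.index_eq_card]; rfl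
  haveI : Finite (periodLattice f ⧸ H) := by
    rw [← AddSubgroup.index_ne_zero_iff_finite]
    exact fun h ↦ relIndex_ne_zero f (hidx.trans (AddSubgroup.index_eq_card H) ▸ h ▸ rfl)
  haveI : Fact p.Prime := ⟨hp⟩
  -- membership in `H` of a multiple, read in `ℂ`
  have hmem : ∀ (x : periodLattice f) (n : ℕ), n • x ∈ H ↔ (n : ℂ) * (x : ℂ) ∈ periodLatticeGamma1 f := by
    intro x n
    rw [hH, AddSubgroup.mem_addSubgroupOf, AddSubgroup.coe_nsmul, nsmul_eq_mul]
  constructor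
  · intro hdvd hS
    rw [hidx] at hdvd
    obtain ⟨q, hq⟩ := exists_prime_addOrderOf_dvd_card' (G := periodLattice f ⧸ H) p hdvd
    obtain ⟨x, rfl⟩ := QuotientAddGroup.mk_surjective q
    -- `p • x ∈ Λ₁`, hence `x ∈ Λ₁` by the hypothesis, hence the class is `0`: order `1 ≠ p`
    have hpx : p • x ∈ H := by
      rw [← QuotientAddGroup.eq_zero_iff, QuotientAddGroup.mk_nsmul, ← hq]
      exact addOrderOf_nsmul_eq_zero _
    have hx : (x : ℂ) ∈ periodLatticeGamma1 f := hS x x.2 ((hmem x p).mp hpx)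
    have hx0 : (QuotientAddGroup.mk x : periodLattice f ⧸ H) = 0 := by
      rw [QuotientAddGroup.eq_zero_iff, hH, AddSubgroup.mem_addSubgroupOf]
      exact hx
    rw [hx0, addOrderOf_zero] at hq
    exact hp.one_lt.ne hq
  · intro hS
    unfold ShimuraIndexPrimeTo at hS
    push Not at hS
    obtain ⟨x, hx, hpx, hx1⟩ := hS
    set q : periodLattice f ⧸ H := QuotientAddGroup.mk ⟨x, hx⟩ with hqdef
    have hq0 : q ≠ 0 := by
      rw [hqdef, Ne, QuotientAddGroup.eq_zero_iff, hH, AddSubgroup.mem_addSubgroupOf]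
      exact hx1
    have hpq : p • q = 0 := by
      rw [hqdef, ← QuotientAddGroup.mk_nsmul, QuotientAddGroup.eq_zero_iff]
      exact (hmem ⟨x, hx⟩ p).mpr hpx
    have hord : addOrderOf q = p := by
      rcases hp.eq_one_or_self_of_dvd _ (addOrderOf_dvd_of_nsmul_eq_zero hpq) with h1 | h1
      · exact absurd (AddMonoid.addOrderOf_eq_one_iff.mp h1) hq0
      · exact h1
    rw [hidx, ← hord]
    exact addOrderOf_dvd_natCard q

/-- `ShimuraIndexPrimeTo p f ↔ p ∤ [Λ₀(f) : Λ₁(f)]`. [cite: LingOesterle1991, §1] -/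
theorem shimuraIndexPrimeTo_iff_not_dvd_relIndex {p : ℕ} (hp : p.Prime) :
    ShimuraIndexPrimeTo p f ↔ ¬ p ∣ (periodLatticeGamma1 f).relIndex (periodLattice f) := by
  rw [dvd_relIndex_iff_not_shimuraIndexPrimeTo f hp, not_not]

omit [NeZero N] in
/-- `[Λ₀(f) : Λ₁(f)] = 1 ↔ Λ₁(f) = Λ₀(f)` («Stevens' lattice = the optimal lattice»). [cite: Stevens1989, §2] -/
theorem relIndex_eq_one_iff : (periodLatticeGamma1 f).relIndex (periodLattice f) = 1 ↔ periodLatticeGamma1 f = periodLattice f := by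
  rw [AddSubgroup.relIndex_eq_one]
  exact ⟨fun h ↦ le_antisymm (periodLatticeGamma1_le_periodLattice f) h, fun h ↦ h.ge⟩

/-- `[Λ₀(f) : Λ₁(f)] = 2 ⟹ ¬ ShimuraIndexPrimeTo 2 f` and `Λ₁(f) ≠ Λ₀(f)`. [cite: LingOesterle1991, §1] -/
theorem not_shimuraIndexPrimeTo_two_of_relIndex_eq_two (h : (periodLatticeGamma1 f).relIndex (periodLattice f) = 2) :
    ¬ ShimuraIndexPrimeTo 2 f ∧ periodLatticeGamma1 f ≠ periodLattice f := by
  refine ⟨(dvd_relIndex_iff_not_shimuraIndexPrimeTo f Nat.prime_two).mp (h ▸ dvd_rfl), fun he ↦ ?_⟩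
  have h1 := (relIndex_eq_one_iff f).mpr he
  omega

/-- At an odd prime `p`, `[Λ₀(f) : Λ₁(f)] = 2 ⟹ ShimuraIndexPrimeTo p f`. [cite: LingOesterle1991, §1] -/
theorem shimuraIndexPrimeTo_of_relIndex_eq_two {p : ℕ} (hp : p.Prime) (hp2 : p ≠ 2)
    (h : (periodLatticeGamma1 f).relIndex (periodLattice f) = 2) : ShimuraIndexPrimeTo p f := by
  rw [shimuraIndexPrimeTo_iff_not_dvd_relIndex f hp, h]
  intro hd
  exact hp2 ((Nat.prime_dvd_prime_iff_eq hp Nat.prime_two).mp hd)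

end Dictionary

/-! ## §2. Exact values by transport along `χ₋₄`-edges from the levels `20` and `24` -/

section Twins

variable {W W' : WeierstrassCurve ℚ} [W.IsElliptic] [W'.IsElliptic] {N' : ℕ} [NeZero N']

/-- **`[Λ₀(f_{D′}) : Λ₁(f_{D′})] = 2` for the `χ₋₄`-twins of the level-`20` data**: `D` any `X₀(20)`-datum of `W`, `D′` any datum of
`W′ ~ W ⊗ χ₋₄` at a level `N′` with `20 ∣ N′ ∣ 80`, `16 ∣ N′` (so `N′ = 80`), both curves additive at `2`.  The index is a `χ₋₄`-orbit
invariant (tree `relIndex_periodLatticeGamma1_eq_of_negOne_twist_of_dvd`) and equals `2` for every `f ≠ 0` on `Γ₀(20)` (tree `relIndex_twenty`).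
[cite: Stevens1989, §2 and Lemma (5.4)] [cite: LingOesterle1991, Thm. 1] -/
theorem relIndex_eq_two_of_negOne_twist_twenty (D : ModularParametrizationData W 20) (D' : ModularParametrizationData W' N')
    (hN' : 20 ∣ N') (hN'4 : N' ∣ 4 * 20) (h16 : 4 ^ 2 ∣ N') (h4W : 2 ^ 2 ∣ W.conductorNorm ℤ) (h4W' : 2 ^ 2 ∣ W'.conductorNorm ℤ)
    (hiso : IsIsogenous (W.quadraticTwist ((-1 : ℤ) : ℚ)) W') :
    (periodLatticeGamma1 D'.f).relIndex (periodLattice D'.f) = 2 := by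
  rw [← relIndex_periodLatticeGamma1_eq_of_negOne_twist_of_dvd D D' hN' hN'4 h16 h4W h4W' hiso]
  exact relIndex_twenty D.f D.isNewformOf.1.ne_zero

/-- **`[Λ₀(f_{D′}) : Λ₁(f_{D′})] = 2` for the `χ₋₄`-twins of the level-`24` data** (`24 ∣ N′ ∣ 96`, `16 ∣ N′`: `N′ = 48` for the twin's
newform, the value `96` being vacuous; tree `relIndex_twentyFour`). [cite: Stevens1989, §2 and Lemma (5.4)] [cite: LingOesterle1991, Thm. 1] -/
theorem relIndex_eq_two_of_negOne_twist_twentyFour (D : ModularParametrizationData W 24) (D' : ModularParametrizationData W' N')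
    (hN' : 24 ∣ N') (hN'4 : N' ∣ 4 * 24) (h16 : 4 ^ 2 ∣ N') (h4W : 2 ^ 2 ∣ W.conductorNorm ℤ) (h4W' : 2 ^ 2 ∣ W'.conductorNorm ℤ)
    (hiso : IsIsogenous (W.quadraticTwist ((-1 : ℤ) : ℚ)) W') :
    (periodLatticeGamma1 D'.f).relIndex (periodLattice D'.f) = 2 := by
  rw [← relIndex_periodLatticeGamma1_eq_of_negOne_twist_of_dvd D D' hN' hN'4 h16 h4W h4W' hiso]
  exact relIndex_twentyFour D.f D.isNewformOf.1.ne_zero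

/-- **LEVEL `80` (genus `7`): `[Λ₀(f) : Λ₁(f)] = 2`** for the newform of every `X₀(80)`-datum of a curve `W′ ~ W ⊗ χ₋₄`, `W` a curve with an
`X₀(20)`-datum (the class `80b = 20a ⊗ χ₋₄`; E15 `80b1 ↦ 2`), both additive at `2`. [cite: Stevens1989, §2] [cite: LingOesterle1991, Thm. 1] -/
theorem relIndex_eighty_of_negOne_twist (D : ModularParametrizationData W 20) (D' : ModularParametrizationData W' 80)
    (h4W : 2 ^ 2 ∣ W.conductorNorm ℤ) (h4W' : 2 ^ 2 ∣ W'.conductorNorm ℤ) (hiso : IsIsogenous (W.quadraticTwist ((-1 : ℤ) : ℚ)) W') :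
    (periodLatticeGamma1 D'.f).relIndex (periodLattice D'.f) = 2 :=
  relIndex_eq_two_of_negOne_twist_twenty D D' (by norm_num) (by norm_num) (by norm_num) h4W h4W' hiso

/-- **LEVEL `48` (genus `3`): `[Λ₀(f) : Λ₁(f)] = 2`** for the newform of every `X₀(48)`-datum of a curve `W′ ~ W ⊗ χ₋₄`, `W` a curve with an
`X₀(24)`-datum (the class `48a = 24a ⊗ χ₋₄`; E15 `48a1 ↦ 2`), both additive at `2`. [cite: Stevens1989, §2] [cite: LingOesterle1991, Thm. 1] -/
theorem relIndex_fortyEight_of_negOne_twist (D : ModularParametrizationData W 24) (D' : ModularParametrizationData W' 48)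
    (h4W : 2 ^ 2 ∣ W.conductorNorm ℤ) (h4W' : 2 ^ 2 ∣ W'.conductorNorm ℤ) (hiso : IsIsogenous (W.quadraticTwist ((-1 : ℤ) : ℚ)) W') :
    (periodLatticeGamma1 D'.f).relIndex (periodLattice D'.f) = 2 :=
  relIndex_eq_two_of_negOne_twist_twentyFour D D' (by norm_num) (by norm_num) (by norm_num) h4W h4W' hiso

/-- … so at level `80` the newform SEES the Shimura `2`-class: `¬ ShimuraIndexPrimeTo 2 f_{D′}`, and Stevens' lattice is a proper
sublattice, `Λ₁(f_{D′}) ≠ Λ₀(f_{D′})` (the strong `X₁(80)`-curve of the class is not the strong `X₀(80)`-curve). [cite: Stevens1989, §2] -/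
theorem not_shimuraIndexPrimeTo_two_eighty_of_negOne_twist (D : ModularParametrizationData W 20)
    (D' : ModularParametrizationData W' 80) (h4W : 2 ^ 2 ∣ W.conductorNorm ℤ) (h4W' : 2 ^ 2 ∣ W'.conductorNorm ℤ)
    (hiso : IsIsogenous (W.quadraticTwist ((-1 : ℤ) : ℚ)) W') :
    ¬ ShimuraIndexPrimeTo 2 D'.f ∧ periodLatticeGamma1 D'.f ≠ periodLattice D'.f :=
  not_shimuraIndexPrimeTo_two_of_relIndex_eq_two D'.f (relIndex_eighty_of_negOne_twist D D' h4W h4W' hiso)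

/-- … and at level `48`: `¬ ShimuraIndexPrimeTo 2 f_{D′}` and `Λ₁(f_{D′}) ≠ Λ₀(f_{D′})`. [cite: Stevens1989, §2] -/
theorem not_shimuraIndexPrimeTo_two_fortyEight_of_negOne_twist (D : ModularParametrizationData W 24)
    (D' : ModularParametrizationData W' 48) (h4W : 2 ^ 2 ∣ W.conductorNorm ℤ) (h4W' : 2 ^ 2 ∣ W'.conductorNorm ℤ)
    (hiso : IsIsogenous (W.quadraticTwist ((-1 : ℤ) : ℚ)) W') :
    ¬ ShimuraIndexPrimeTo 2 D'.f ∧ periodLatticeGamma1 D'.f ≠ periodLattice D'.f :=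
  not_shimuraIndexPrimeTo_two_of_relIndex_eq_two D'.f (relIndex_fortyEight_of_negOne_twist D D' h4W h4W' hiso)

/-- … while the ODD part of the quotient is trivial at both twins: `ShimuraIndexPrimeTo p f_{D′}` for every odd prime `p` at `80` …
[cite: LingOesterle1991, Thm. 1] -/
theorem shimuraIndexPrimeTo_odd_eighty_of_negOne_twist (D : ModularParametrizationData W 20)
    (D' : ModularParametrizationData W' 80) (h4W : 2 ^ 2 ∣ W.conductorNorm ℤ) (h4W' : 2 ^ 2 ∣ W'.conductorNorm ℤ)
    (hiso : IsIsogenous (W.quadraticTwist ((-1 : ℤ) : ℚ)) W') {p : ℕ} (hp : p.Prime) (hp2 : p ≠ 2) :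
    ShimuraIndexPrimeTo p D'.f :=
  shimuraIndexPrimeTo_of_relIndex_eq_two D'.f hp hp2 (relIndex_eighty_of_negOne_twist D D' h4W h4W' hiso)

/-- … and at `48`. [cite: LingOesterle1991, Thm. 1] -/
theorem shimuraIndexPrimeTo_odd_fortyEight_of_negOne_twist (D : ModularParametrizationData W 24)
    (D' : ModularParametrizationData W' 48) (h4W : 2 ^ 2 ∣ W.conductorNorm ℤ) (h4W' : 2 ^ 2 ∣ W'.conductorNorm ℤ)
    (hiso : IsIsogenous (W.quadraticTwist ((-1 : ℤ) : ℚ)) W') {p : ℕ} (hp : p.Prime) (hp2 : p ≠ 2) :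
    ShimuraIndexPrimeTo p D'.f :=
  shimuraIndexPrimeTo_of_relIndex_eq_two D'.f hp hp2 (relIndex_fortyEight_of_negOne_twist D D' h4W h4W' hiso)

end Twins

/-! ## §3. Level `48` DECIDED — `[Λ₀(φ₄₈) : Λ₁(φ₄₈)] = 2` for every `X₀(48)`-datum — and the `20a1`-side of level `80`, modularity binder only -/

section FortyEight

/-- **`24a1 ⊗ χ₋₄ ≅ 48a1` on the tree's models**: the `(−1)`-twist `[0, 1, 0, −4, −4]` of `[0, −1, 0, −4, 4]` (`24a1`, `…NeronSqueezeTwentyFour`)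
is the translate `x ↦ x − 1` of `[0, −2, 0, −3, 0]` (`48a1`, `…EtaIdentitiesFortyEight`); hence the two are isogenous over `ℚ`.
[cite: CremonaAlgorithms1997, Table 1 (24a1, 48a1)] -/
theorem isIsogenous_quadraticTwist_twentyFourA1_fortyEightA1 :
    IsIsogenous ((⟨0, -1, 0, -4, 4⟩ : WeierstrassCurve ℚ).quadraticTwist ((-1 : ℤ) : ℚ)) (⟨0, -2, 0, -3, 0⟩ : WeierstrassCurve ℚ) :=
  isIsogenous_of_smul_eq (C := ⟨1, -1, 0, 0⟩) (by
    ext <;> simp [variableChange_a₁, variableChange_a₂, variableChange_a₃, variableChange_a₄, variableChange_a₆, quadraticTwist,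
      b₂, b₄, b₆] <;> norm_num)

/-- **LEVEL `48` DECIDED: `[Λ₀(f_D) : Λ₁(f_D)] = 2` for EVERY `X₀(48)`-datum `D` of EVERY elliptic `W/ℚ`**, assuming only the item's
modularity binder `exists_isNewformOf` (used to produce auxiliary data of `24a1` at level `24` and of `48a1` at level `48`; the
pinning `f_D = φ₄₈ = η₄⁴η₁₂⁴/(η₂η₆η₈η₂₄)` of `…NewformPinningFortyEight` makes the conclusion independent of `W`).  The Shimura quotient
of the genus-`3` curve `X₀(48)` at its newform is `ℤ/2` — the strong `X₁(48)`-curve of the class `48a` is NOT `X₀(48)`-optimal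
(E15 `48a1 ↦ 2` ✓).
No CDT, no printed Manin-constant fact.
[cite: Stevens1989, §2 and Lemma (5.4)] [cite: LingOesterle1991, Thm. 1] [cite: CremonaAlgorithms1997, Table 3 (N = 48)] -/
theorem relIndex_eq_two_fortyEight (hnf : exists_isNewformOf) {W' : WeierstrassCurve ℚ} [W'.IsElliptic]
    (D' : ModularParametrizationData W' 48) : (periodLatticeGamma1 D'.f).relIndex (periodLattice D'.f) = 2 := by
  haveI := isElliptic_twentyFourA1
  haveI := isElliptic_fortyEightA1
  obtain ⟨f₂₄, hf₂₄⟩ := exists_isNewformOf_twentyFourA1 hnf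
  obtain ⟨D⟩ := nonempty_modularParametrizationData_of_isNewformOf hf₂₄
  obtain ⟨f₄₈, hf₄₈⟩ := exists_isNewformOf_fortyEightA1 hnf
  obtain ⟨D₀⟩ := nonempty_modularParametrizationData_of_isNewformOf hf₄₈
  have h₀ : (periodLatticeGamma1 D₀.f).relIndex (periodLattice D₀.f) = 2 :=
    relIndex_fortyEight_of_negOne_twist D D₀ (by rw [conductorNorm_twentyFourA1]; norm_num) (by rw [conductorNorm_fortyEightA1]; norm_num)
      isIsogenous_quadraticTwist_twentyFourA1_fortyEightA1
  obtain ⟨φ, hφ⟩ := exists_cuspForm_phi48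
  rw [f_eq_phi48 φ hφ D', ← f_eq_phi48 φ hφ D₀]
  exact h₀

/-- … hence at level `48`: `¬ ShimuraIndexPrimeTo 2 f_D` and `Λ₁(f_D) ≠ Λ₀(f_D)` for every datum (modularity binder only). [cite: Stevens1989, §2] -/
theorem not_shimuraIndexPrimeTo_two_fortyEight (hnf : exists_isNewformOf) {W' : WeierstrassCurve ℚ} [W'.IsElliptic]
    (D' : ModularParametrizationData W' 48) : ¬ ShimuraIndexPrimeTo 2 D'.f ∧ periodLatticeGamma1 D'.f ≠ periodLattice D'.f :=
  not_shimuraIndexPrimeTo_two_of_relIndex_eq_two D'.f (relIndex_eq_two_fortyEight hnf D')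

/-- … and `ShimuraIndexPrimeTo p f_D` for every ODD prime `p` at level `48` (modularity binder only). [cite: LingOesterle1991, Thm. 1] -/
theorem shimuraIndexPrimeTo_odd_fortyEight (hnf : exists_isNewformOf) {W' : WeierstrassCurve ℚ} [W'.IsElliptic]
    (D' : ModularParametrizationData W' 48) {p : ℕ} (hp : p.Prime) (hp2 : p ≠ 2) : ShimuraIndexPrimeTo p D'.f :=
  shimuraIndexPrimeTo_of_relIndex_eq_two D'.f hp hp2 (relIndex_eq_two_fortyEight hnf D')

/-- **The Shimura index of `φ₄₈` itself**: for every cusp form `φ` on `Γ₀(48)` with the `η`-product expansion of `φ₄₈`,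
`[Λ₀(φ) : Λ₁(φ)] = 2` (modularity binder only). [cite: CremonaAlgorithms1997, Table 3 (N = 48)] [cite: Stevens1989, §2] -/
theorem relIndex_phi48_eq_two (hnf : exists_isNewformOf) (φ : CuspForm (Gamma0 48) 2)
    (hφ : ⇑φ = etaQuotient 48 (expFn [(2, -1), (4, 4), (6, -1), (8, -1), (12, 4), (24, -1)])) :
    (periodLatticeGamma1 φ).relIndex (periodLattice φ) = 2 := by
  haveI := isElliptic_fortyEightA1
  obtain ⟨f₄₈, hf₄₈⟩ := exists_isNewformOf_fortyEightA1 hnf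
  obtain ⟨D₀⟩ := nonempty_modularParametrizationData_of_isNewformOf hf₄₈
  rw [← f_eq_phi48 φ hφ D₀]
  exact relIndex_eq_two_fortyEight hnf D₀

/-- **LEVEL `80`, the `20a1`-side discharged**: for every elliptic `W′` additive at `2` and isogenous over `ℚ` to
`20a1 ⊗ χ₋₄ = [0, −1, 0, 4, −4]` (the class `80b`) and every `X₀(80)`-datum `D′` of `W′`, `[Λ₀(f_{D′}) : Λ₁(f_{D′})] = 2` — assuming only
the modularity binder (which supplies the auxiliary `X₀(20)`-datum of Cremona's literal `20a1 = [0, 1, 0, 4, 4]`, `…NonVacuityTwenty`).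
No newform pinning at the genus-`7` level `80` is used or available, whence the residual twin hypothesis on `W′`.
[cite: Stevens1989, §2 and Lemma (5.4)] [cite: LingOesterle1991, Thm. 1] [cite: CremonaAlgorithms1997, Table 1 (20a1, 80b1)] -/
theorem relIndex_eq_two_eighty_of_isIsogenous_twentyA1_twist (hnf : exists_isNewformOf) {W' : WeierstrassCurve ℚ} [W'.IsElliptic]
    (D' : ModularParametrizationData W' 80) (h4W' : 2 ^ 2 ∣ W'.conductorNorm ℤ)
    (hiso : IsIsogenous ((⟨0, 1, 0, 4, 4⟩ : WeierstrassCurve ℚ).quadraticTwist ((-1 : ℤ) : ℚ)) W') :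
    (periodLatticeGamma1 D'.f).relIndex (periodLattice D'.f) = 2 := by
  haveI := isElliptic_20a1
  obtain ⟨f₂₀, hf₂₀⟩ := exists_isNewformOf_twentyA1 hnf
  obtain ⟨D⟩ := nonempty_modularParametrizationData_of_isNewformOf hf₂₀
  exact relIndex_eighty_of_negOne_twist D D' (by rw [conductorNorm_twentyA1]; norm_num) h4W' hiso

/-- The twist model named: `20a1 ⊗ χ₋₄ = [0, 1, 0, 4, 4]^{(−1)} = [0, −1, 0, 4, −4]` literally (tree `quadraticTwist`).
[cite: CremonaAlgorithms1997, Table 1 (20a1, 80b1)] -/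
theorem quadraticTwist_negOne_twentyA1 :
    (⟨0, 1, 0, 4, 4⟩ : WeierstrassCurve ℚ).quadraticTwist ((-1 : ℤ) : ℚ) = ⟨0, -1, 0, 4, -4⟩ := by
  ext <;> norm_num [quadraticTwist, b₂, b₄, b₆]

end FortyEight

/-! ## §4. Root number `−1` at one end of a `χ₋₄`-edge ⟹ `Λ₁ = Λ₀` at both ends -/

section RootNumber

variable {W W' : WeierstrassCurve ℚ} [W.IsElliptic] [W'.IsElliptic] {N N' : ℕ} [NeZero N] [NeZero N']

/-- **`Λ₁ = Λ₀` FROM AN ODD-RANK TWIN ABOVE**: `D` a datum of `W` at level `N`, `W′ ~ W ⊗ χ₋₄` globally minimal of root number `−1` with a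
datum `D′` at its conductor `N′ = N(W′)`, `N ∣ N′ ∣ 4N`, `16 ∣ N′`, `W` additive at `2` ⟹ `Λ₁(f_D) = Λ₀(f_D)`.  (Tree: root number `−1` ⟹
Fricke sign `+1` ⟹ `φ₀(0) = O` ⟹ `Λ₁ = Λ₀` at `D′`, `periodLatticeGamma1_eq_of_rootNumber_eq_neg_one`; then the `χ₋₄`-orbit property
`periodLatticeGamma1_eq_iff_of_negOne_twist_of_dvd`.)  Census: `56b1 ↦ 1` (E15) from the rank-one twin `112a1`, although `56b1` has root
number `+1`, all `a_ℓ(56b)`, `ℓ ∤ 14`, are even (rational `2`-torsion) and its one minus Atkin–Lehner divisor `Q = 7` has `φ(7)` even, so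
neither the Fricke criterion, nor the Eisenstein sieve, nor cuspidal inertia / Atkin–Lehner parity decides it at level `56`.
[cite: Stevens1989, §2 and Lemma (5.4)] -/
theorem periodLatticeGamma1_eq_of_negOne_twist_of_rootNumber_twin [W'.IsGloballyMinimal] [NeZero (W'.conductorNorm ℤ)]
    (D : ModularParametrizationData W N) (D' : ModularParametrizationData W' (W'.conductorNorm ℤ))
    (hNN' : N ∣ W'.conductorNorm ℤ) (hN'4 : W'.conductorNorm ℤ ∣ 4 * N) (h16 : 4 ^ 2 ∣ W'.conductorNorm ℤ)
    (h4W : 2 ^ 2 ∣ W.conductorNorm ℤ) (hiso : IsIsogenous (W.quadraticTwist ((-1 : ℤ) : ℚ)) W') (hw : W'.rootNumber = -1) :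
    periodLatticeGamma1 D.f = periodLattice D.f :=
  (periodLatticeGamma1_eq_iff_of_negOne_twist_of_dvd D D' hNN' hN'4 h16 h4W (dvd_trans ⟨4, by norm_num⟩ h16) hiso).mp
    (periodLatticeGamma1_eq_of_rootNumber_eq_neg_one D' hw)

/-- … in index form: `[Λ₀(f_D) : Λ₁(f_D)] = 1`. [cite: Stevens1989, §2] -/
theorem relIndex_eq_one_of_negOne_twist_of_rootNumber_twin [W'.IsGloballyMinimal] [NeZero (W'.conductorNorm ℤ)]
    (D : ModularParametrizationData W N) (D' : ModularParametrizationData W' (W'.conductorNorm ℤ))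
    (hNN' : N ∣ W'.conductorNorm ℤ) (hN'4 : W'.conductorNorm ℤ ∣ 4 * N) (h16 : 4 ^ 2 ∣ W'.conductorNorm ℤ)
    (h4W : 2 ^ 2 ∣ W.conductorNorm ℤ) (hiso : IsIsogenous (W.quadraticTwist ((-1 : ℤ) : ℚ)) W') (hw : W'.rootNumber = -1) :
    (periodLatticeGamma1 D.f).relIndex (periodLattice D.f) = 1 :=
  (relIndex_eq_one_iff D.f).mpr (periodLatticeGamma1_eq_of_negOne_twist_of_rootNumber_twin D D' hNN' hN'4 h16 h4W hiso hw)

/-- **`Λ₁ = Λ₀` FROM AN ODD-RANK TWIN BELOW**: `W` globally minimal of root number `−1` with a datum `D` at its conductor `N = N(W)`,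
`D′` a datum of `W′ ~ W ⊗ χ₋₄` at `N′`, `N ∣ N′ ∣ 4N`, `16 ∣ N′`, both additive at `2` ⟹ `Λ₁(f_{D′}) = Λ₀(f_{D′})`.  Census shape:
the edge `128 ∣ 128` from the rank-one class `128a1` (E15: `128a1 ↦ 1`; predicted twin `128c1 ↦ 1` ✓). [cite: Stevens1989, §2 and Lemma (5.4)] -/
theorem periodLatticeGamma1_eq_of_rootNumber_eq_neg_one_of_negOne_twist [W.IsGloballyMinimal] [NeZero (W.conductorNorm ℤ)]
    (D : ModularParametrizationData W (W.conductorNorm ℤ)) (D' : ModularParametrizationData W' N')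
    (hNN' : W.conductorNorm ℤ ∣ N') (hN'4 : N' ∣ 4 * W.conductorNorm ℤ) (h16 : 4 ^ 2 ∣ N') (h4W : 2 ^ 2 ∣ W.conductorNorm ℤ)
    (h4W' : 2 ^ 2 ∣ W'.conductorNorm ℤ) (hiso : IsIsogenous (W.quadraticTwist ((-1 : ℤ) : ℚ)) W') (hw : W.rootNumber = -1) :
    periodLatticeGamma1 D'.f = periodLattice D'.f :=
  (periodLatticeGamma1_eq_iff_of_negOne_twist_of_dvd D D' hNN' hN'4 h16 h4W h4W' hiso).mpr
    (periodLatticeGamma1_eq_of_rootNumber_eq_neg_one D hw)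

/-- … in index form: `[Λ₀(f_{D′}) : Λ₁(f_{D′})] = 1`. [cite: Stevens1989, §2] -/
theorem relIndex_eq_one_of_rootNumber_eq_neg_one_of_negOne_twist [W.IsGloballyMinimal] [NeZero (W.conductorNorm ℤ)]
    (D : ModularParametrizationData W (W.conductorNorm ℤ)) (D' : ModularParametrizationData W' N')
    (hNN' : W.conductorNorm ℤ ∣ N') (hN'4 : N' ∣ 4 * W.conductorNorm ℤ) (h16 : 4 ^ 2 ∣ N') (h4W : 2 ^ 2 ∣ W.conductorNorm ℤ)
    (h4W' : 2 ^ 2 ∣ W'.conductorNorm ℤ) (hiso : IsIsogenous (W.quadraticTwist ((-1 : ℤ) : ℚ)) W') (hw : W.rootNumber = -1) :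
    (periodLatticeGamma1 D'.f).relIndex (periodLattice D'.f) = 1 :=
  (relIndex_eq_one_iff D'.f).mpr (periodLatticeGamma1_eq_of_rootNumber_eq_neg_one_of_negOne_twist D D' hNN' hN'4 h16 h4W h4W' hiso hw)

/-- … hence `ShimuraIndexPrimeTo p f_{D′}` for EVERY prime `p` there. [cite: Stevens1989, §2] -/
theorem shimuraIndexPrimeTo_of_rootNumber_eq_neg_one_of_negOne_twist [W.IsGloballyMinimal] [NeZero (W.conductorNorm ℤ)]
    (D : ModularParametrizationData W (W.conductorNorm ℤ)) (D' : ModularParametrizationData W' N')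
    (hNN' : W.conductorNorm ℤ ∣ N') (hN'4 : N' ∣ 4 * W.conductorNorm ℤ) (h16 : 4 ^ 2 ∣ N') (h4W : 2 ^ 2 ∣ W.conductorNorm ℤ)
    (h4W' : 2 ^ 2 ∣ W'.conductorNorm ℤ) (hiso : IsIsogenous (W.quadraticTwist ((-1 : ℤ) : ℚ)) W') (hw : W.rootNumber = -1)
    {p : ℕ} (hp : p.Prime) : ShimuraIndexPrimeTo p D'.f := by
  rw [shimuraIndexPrimeTo_iff_not_dvd_relIndex D'.f hp,
    relIndex_eq_one_of_rootNumber_eq_neg_one_of_negOne_twist D D' hNN' hN'4 h16 h4W h4W' hiso hw]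
  exact hp.one_lt.ne' ∘ Nat.dvd_one.mp

end RootNumber

/-! ## §5. The conditional edge `52 → 208` -/

section FiftyTwo

variable {W W' : WeierstrassCurve ℚ} [W.IsElliptic] [W'.IsElliptic] {N' : ℕ} [NeZero N']

/-- **`[Λ₀ : Λ₁] = 2` for the `χ₋₄`-twins at `N′ = 208` of the level-`52` data, FROM THE LEVEL-`52` HECKE DATUM**
`(T₃ − 1)(T₃ + 3)·S₂(Γ₀(52)) ⊆ ℂ·f_D` (tree `relIndex_fiftyTwo_of_heckeDatum`; E15 `52a1 ↦ 2`, `208c1 ↦ 2`, `208c = 52a ⊗ χ₋₄`).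
[cite: Stevens1989, §2 and Lemma (5.4)] [cite: CremonaAlgorithms1997, Tables 3 and 5] -/
theorem relIndex_eq_two_of_negOne_twist_fiftyTwo_of_heckeDatum (D : ModularParametrizationData W 52)
    (hsep : ∀ g : CuspForm (Gamma0 52) 2, ∃ c : ℂ, separatorFiftyTwo g = c • D.f) (D' : ModularParametrizationData W' N')
    (hN' : 52 ∣ N') (hN'4 : N' ∣ 4 * 52) (h16 : 4 ^ 2 ∣ N') (h4W : 2 ^ 2 ∣ W.conductorNorm ℤ) (h4W' : 2 ^ 2 ∣ W'.conductorNorm ℤ)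
    (hiso : IsIsogenous (W.quadraticTwist ((-1 : ℤ) : ℚ)) W') :
    (periodLatticeGamma1 D'.f).relIndex (periodLattice D'.f) = 2 := by
  rw [← relIndex_periodLatticeGamma1_eq_of_negOne_twist_of_dvd D D' hN' hN'4 h16 h4W h4W' hiso]
  exact relIndex_fiftyTwo_of_heckeDatum W D hsep

end FiftyTwo

end Summit.BirchSwinnertonDyer.BirchSwinnertonDyer.Theorems.ManinLocalTwoThree.ShimuraIndex

end
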